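import Literature.MathematicalPhysics.QuantumManyBody.PuffCubicMomentOperator
import Literature.MathematicalPhysics.QuantumManyBody.PeriodicInteractionHessianPhaseSum
import Summits.AtomisticToContinuum.BoseEinsteinCondensation.Theses.BECPhaseQuadratureSumRule

/-!
# Route `BECPhaseQuadratureSumRule`, support `CurrentSumRule` (stmt-AtomisticToContinuum-12618), I:
# real amplitudes — the test functions `ρ_k u`, `A_k u`, the f-sum rule, the phase weight

Supports stmt-AtomisticToContinuum-12618 (`CurrentSumRule`, the sum-rule engine `m₂² ≤ 4 m₁ M₃`).
For a *real* amplitude `u` on the `N`-particle torus `(ℝ³/Lℤ³)^N` (later: the real and the imaginary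
part of a complex minimiser), a mode `m` with wave vector `k = 2πm/L`, `κ = ‖k‖²`, `eⱼ = e^{ik·xⱼ}`
(`cellWave L m (X j)`), `∂ⱼ = k·∇_{xⱼ}` and Feynman's density wave `ρ_k = ∑ⱼ eⱼ`:

* admissibility (smoothness, lattice periodicity, Bose symmetry) of `ρ_k u` and of the commutator
  amplitude `A_k u = ∑ⱼ eⱼ(κu - 2i∂ⱼu) = ([H, ρ_k]u)` for a general real `u`;
* `integral_conj_rhoAmp_mul_commAmp` — **the f-sum rule for a real amplitude**:
  `∫ conj(ρ_k u) A_k u = Nκ ∫ u²` (one periodic integration by parts per pair `(j, l)`: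
  `∫ eⱼēₗ u(-2i∂ⱼu) = -α_{jl}∫ eⱼēₗ u²`, `α_{jl} = κ[j ≠ l]`, so only `j = l` survives);
* `norm_cellWave_sub_cellWave_sq` — the phase weight `|e_a - e_b|² = 2(1 - cos k·(x_a - x_b))`.

References: D. Pines, P. Nozières, *The Theory of Quantum Liquids* I (1966) §2.4; S. Stringari, in
*Bose–Einstein Condensation* (CUP 1995) §2.3 (20); R. D. Puff, Phys. Rev. 137 (1965) A406.
-/

noncomputable section

namespace Summit.AtomisticToContinuum.BoseEinsteinCondensation.Theorems

open MeasureTheory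
open scoped ENNReal NNReal BigOperators ComplexConjugate
open Literature.MathematicalPhysics.QuantumManyBody.BoseGas

namespace CurrentSumRule

variable {N : ℕ} {L : ℝ}

/-! ### Plane waves in one particle: periodicity -/

/-- `X ↦ e_m(x_l)` is lattice periodic in every particle (local copy). [folklore] -/
theorem cellWave_comp_apply_periodic (hL : L ≠ 0) (m : Fin 3 → ℤ) (l : Fin N) (X : Config N)
    (i : Fin N) (c : Fin 3) :
    cellWave L m ((X + Pi.single i (EuclideanSpace.single c L) : Config N) l) = cellWave L m (X l) := by
  rw [Pi.add_apply]
  by_cases hli : l = i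
  · subst hli
    rw [Pi.single_eq_same, cellWave_periodic hL]
  · rw [Pi.single_eq_of_ne hli, add_zero]

/-- The density wave `ρ_k = ∑ⱼ e_m(xⱼ)` is lattice periodic. [folklore] -/
theorem rho_periodic (hL : L ≠ 0) (m : Fin 3 → ℤ) (X : Config N) (i : Fin N) (c : Fin 3) :
    ∑ j : Fin N, cellWave L m ((X + Pi.single i (EuclideanSpace.single c L) : Config N) j) =
      ∑ j : Fin N, cellWave L m (X j) :=
  Finset.sum_congr rfl fun j _ => cellWave_comp_apply_periodic hL m j X i c

/-! ### The test amplitudes `ρ_k u` and `A_k u` of a real amplitude -/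

section Amplitudes

variable (L) (m : Fin 3 → ℤ) {u : Config N → ℝ}

/-- `ρ_k u` is `Cʳ` for a `Cʳ` real amplitude. [folklore] -/
theorem contDiff_rhoAmp {r : ℕ∞} (hu : ContDiff ℝ r u) :
    ContDiff ℝ r fun X : Config N => (∑ j : Fin N, cellWave L m (X j)) * ((u X : ℝ) : ℂ) :=
  (ContDiff.sum fun j _ => contDiff_cellWave_comp_apply L m j).mul (contDiff_ofReal_comp hu)

/-- `ρ_k u` is lattice periodic for a lattice-periodic `u`. [folklore] -/
theorem rhoAmp_periodic (hL : L ≠ 0) (huper : IsLatticePeriodic L u) (X : Config N) (i : Fin N)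
    (c : Fin 3) :
    (∑ j : Fin N, cellWave L m ((X + Pi.single i (EuclideanSpace.single c L) : Config N) j)) *
        ((u (X + Pi.single i (EuclideanSpace.single c L)) : ℝ) : ℂ) =
      (∑ j : Fin N, cellWave L m (X j)) * ((u X : ℝ) : ℂ) := by
  rw [huper X i c, rho_periodic hL]

/-- `ρ_k u` is Bose symmetric for a Bose-symmetric `u`. [folklore] -/
theorem rhoAmp_symm (husymm : ∀ (σ : Equiv.Perm (Fin N)) (X : Config N), u (X ∘ σ) = u X)
    (σ : Equiv.Perm (Fin N)) (X : Config N) :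
    (∑ j : Fin N, cellWave L m ((X ∘ σ) j)) * ((u (X ∘ σ) : ℝ) : ℂ) =
      (∑ j : Fin N, cellWave L m (X j)) * ((u X : ℝ) : ℂ) := by
  rw [husymm σ X]
  congr 1
  exact Equiv.sum_comp σ (fun j => cellWave L m (X j))

/-- The commutator amplitude `A = ∑ⱼ eⱼ(κu - 2i∂ⱼu)` is `C²` for a `C³` real amplitude. [folklore] -/
theorem contDiff_commAmp (hu : ContDiff ℝ 3 u) (κ : ℂ) (k : Space) :
    ContDiff ℝ 2 fun X : Config N => ∑ j : Fin N, cellWave L m (X j) *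
      (κ * ((u X : ℝ) : ℂ) - 2 * Complex.I * ((fderiv ℝ u X (Pi.single j k) : ℝ) : ℂ)) := by
  refine ContDiff.sum fun j _ => (contDiff_cellWave_comp_apply L m j).mul ?_
  exact (contDiff_const.mul (contDiff_ofReal_comp (hu.of_le (by norm_num)))).sub
    (contDiff_const.mul (contDiff_ofReal_comp (contDiff_two_fderiv_apply_const hu _)))

/-- `A` is `C¹` for a `C²` real amplitude. [folklore] -/
theorem contDiff_one_commAmp (hu : ContDiff ℝ 2 u) (κ : ℂ) (k : Space) :
    ContDiff ℝ 1 fun X : Config N => ∑ j : Fin N, cellWave L m (X j) *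
      (κ * ((u X : ℝ) : ℂ) - 2 * Complex.I * ((fderiv ℝ u X (Pi.single j k) : ℝ) : ℂ)) := by
  refine ContDiff.sum fun j _ => (contDiff_cellWave_comp_apply L m j).mul ?_
  exact (contDiff_const.mul (contDiff_ofReal_comp (hu.of_le (by norm_num)))).sub
    (contDiff_const.mul (contDiff_ofReal_comp (contDiff_one_fderiv_apply_const hu _)))

/-- `A` is lattice periodic. [folklore] -/
theorem commAmp_periodic (hL : L ≠ 0) (huper : IsLatticePeriodic L u) (κ : ℂ) (k : Space)
    (X : Config N) (i : Fin N) (c : Fin 3) :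
    (∑ j : Fin N, cellWave L m ((X + Pi.single i (EuclideanSpace.single c L) : Config N) j) *
      (κ * ((u (X + Pi.single i (EuclideanSpace.single c L)) : ℝ) : ℂ) - 2 * Complex.I *
        ((fderiv ℝ u (X + Pi.single i (EuclideanSpace.single c L)) (Pi.single j k) : ℝ) : ℂ))) =
    ∑ j : Fin N, cellWave L m (X j) *
      (κ * ((u X : ℝ) : ℂ) - 2 * Complex.I * ((fderiv ℝ u X (Pi.single j k) : ℝ) : ℂ)) := by
  refine Finset.sum_congr rfl fun j _ => ?_
  rw [cellWave_comp_apply_periodic hL m j X i c, huper X i c,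
    fderiv_apply_periodic (f := u) huper _ X i c]

/-- `A` is Bose symmetric (`∂_{xⱼ·k}u(X∘σ) = ∂_{x_{σj}·k}u(X)` and reindexing). [folklore] -/
theorem commAmp_symm (hu : ContDiff ℝ 1 u)
    (husymm : ∀ (σ : Equiv.Perm (Fin N)) (X : Config N), u (X ∘ σ) = u X) (κ : ℂ) (k : Space)
    (σ : Equiv.Perm (Fin N)) (X : Config N) :
    (∑ j : Fin N, cellWave L m ((X ∘ σ) j) *
      (κ * ((u (X ∘ σ) : ℝ) : ℂ) - 2 * Complex.I * ((fderiv ℝ u (X ∘ σ) (Pi.single j k) : ℝ) : ℂ))) =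
    ∑ j : Fin N, cellWave L m (X j) *
      (κ * ((u X : ℝ) : ℂ) - 2 * Complex.I * ((fderiv ℝ u X (Pi.single j k) : ℝ) : ℂ)) := by
  have hud : Differentiable ℝ u := hu.differentiable one_ne_zero
  simp_rw [husymm σ X, fderiv_comp_perm_apply_single hud σ (husymm σ) X]
  exact Equiv.sum_comp σ (fun j => cellWave L m (X j) *
    (κ * ((u X : ℝ) : ℂ) - 2 * Complex.I * ((fderiv ℝ u X (Pi.single j k) : ℝ) : ℂ)))

end Amplitudes

/-! ### The f-sum rule for a real amplitude -/

section FSum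

variable (m : Fin 3 → ℤ) {k : Space} {u : Config N → ℝ}

/-- One pair `(j, l)`: `∫ eⱼēₗ · u · ∂ⱼu = -(i α_{jl}/2) ∫ eⱼēₗ u²` with `α_{jl} = κ[j ≠ l]`
(periodic integration by parts of `∂ⱼ(u²) = 2u∂ⱼu` against the pair phase). [folklore] -/
theorem integral_pairPhase_mul_mul_fderiv (hL : 0 < L) (hk : k = (2 * Real.pi / L) • latticeVec 1 m)
    (hu : ContDiff ℝ 1 u) (huper : IsLatticePeriodic L u) (j l : Fin N) :
    ∫ X in cellN N L, cellWave L m (X j) * conj (cellWave L m (X l)) *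
        (2 * (((u X : ℝ) : ℂ) * ((fderiv ℝ u X (Pi.single j k) : ℝ) : ℂ))) =
      -(Complex.I * (((if j = l then (0 : ℝ) else ‖k‖ ^ 2) : ℝ) : ℂ)) *
        ∫ X in cellN N L, cellWave L m (X j) * conj (cellWave L m (X l)) *
          (((u X : ℝ) : ℂ) * ((u X : ℝ) : ℂ)) := by
  have hud : Differentiable ℝ u := hu.differentiable one_ne_zero
  have huC : ContDiff ℝ 1 (fun X : Config N => ((u X : ℝ) : ℂ)) := contDiff_ofReal_comp hu
  have hG : ContDiff ℝ 1 (fun X : Config N => ((u X : ℝ) : ℂ) * ((u X : ℝ) : ℂ)) := huC.mul huC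
  have hGper : ∀ (X : Config N) (i : Fin N) (c : Fin 3),
      ((u (X + Pi.single i (EuclideanSpace.single c L)) : ℝ) : ℂ) *
          ((u (X + Pi.single i (EuclideanSpace.single c L)) : ℝ) : ℂ) =
        ((u X : ℝ) : ℂ) * ((u X : ℝ) : ℂ) := fun X i c => by rw [huper X i c]
  have hF := contDiff_pairPhase L m (N := N) (n := 1) j l
  have hFper : ∀ (X : Config N) (i : Fin N) (c : Fin 3),
      cellWave L m ((X + Pi.single i (EuclideanSpace.single c L) : Config N) j) *
          conj (cellWave L m ((X + Pi.single i (EuclideanSpace.single c L) : Config N) l)) =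
        cellWave L m (X j) * conj (cellWave L m (X l)) := fun X i c => by
    rw [cellWave_comp_apply_periodic hL.ne' m j X i c, cellWave_comp_apply_periodic hL.ne' m l X i c]
  -- `∂ⱼ(u²) = 2 u ∂ⱼu`
  have hderiv : ∀ X : Config N, fderiv ℝ (fun Y : Config N => ((u Y : ℝ) : ℂ) * ((u Y : ℝ) : ℂ)) X
      (Pi.single j k) = 2 * (((u X : ℝ) : ℂ) * ((fderiv ℝ u X (Pi.single j k) : ℝ) : ℂ)) := by
    intro X
    rw [fderiv_mul_apply (differentiableAt_ofReal_comp (hud X)) (differentiableAt_ofReal_comp (hud X)),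
      fderiv_ofReal_apply (hud X)]
    ring
  have hbp := integral_cellN_mul_fderiv_apply hL hF hG hFper hGper (Pi.single j k)
  simp_rw [hderiv, fderiv_pairPhase_left L m hk j l] at hbp
  rw [hbp, ← integral_neg, ← integral_const_mul]
  refine integral_congr_ae (ae_of_all _ fun X => ?_)
  ring

/-- **The f-sum rule for a real amplitude.** For a real `C¹` lattice-periodic `u` on the torus of
side `L > 0` and a mode `m` (`k = 2πm/L`, `κ = ‖k‖²`):
`∫ conj(ρ_k u) · A_k u = N κ ∫ u²` with `ρ_k u = (∑ⱼeⱼ)u`, `A_k u = ∑ⱼ eⱼ(κu - 2i∂ⱼu)`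
(`= ⟨ρ_k u, [H, ρ_k] u⟩`; the value `½⟨[ρ_k†,[H, ρ_k]]⟩ = Nκ‖u‖²` of the double commutator).
[cite: Stringari1995, §2.3 (20)] -/
theorem integral_conj_rhoAmp_mul_commAmp (hL : 0 < L) (hk : k = (2 * Real.pi / L) • latticeVec 1 m)
    (hu : ContDiff ℝ 1 u) (huper : IsLatticePeriodic L u) :
    ∫ X in cellN N L, conj ((∑ j : Fin N, cellWave L m (X j)) * ((u X : ℝ) : ℂ)) *
        ∑ j : Fin N, cellWave L m (X j) *
          ((((‖k‖ ^ 2 : ℝ) : ℂ)) * ((u X : ℝ) : ℂ) - 2 * Complex.I * ((fderiv ℝ u X (Pi.single j k) : ℝ) : ℂ)) =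
      (((N : ℝ) * ‖k‖ ^ 2 * ∫ X in cellN N L, u X ^ 2 : ℝ) : ℂ) := by
  have hud : Differentiable ℝ u := hu.differentiable one_ne_zero
  have hce : ∀ j : Fin N, Continuous fun X : Config N => cellWave L m (X j) := fun j =>
    (contDiff_cellWave L m).continuous.comp (continuous_apply j)
  have huc : Continuous fun X : Config N => ((u X : ℝ) : ℂ) := Complex.continuous_ofReal.comp hu.continuous
  have hduc : ∀ j : Fin N, Continuous fun X : Config N => ((fderiv ℝ u X (Pi.single j k) : ℝ) : ℂ) :=
    fun j => Complex.continuous_ofReal.comp (continuous_fderiv_apply_const hu _)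
  -- expand into pair blocks
  have hexp : ∀ X : Config N, conj ((∑ j : Fin N, cellWave L m (X j)) * ((u X : ℝ) : ℂ)) *
      ∑ j : Fin N, cellWave L m (X j) *
        ((((‖k‖ ^ 2 : ℝ) : ℂ)) * ((u X : ℝ) : ℂ) - 2 * Complex.I * ((fderiv ℝ u X (Pi.single j k) : ℝ) : ℂ)) =
      ∑ j : Fin N, ∑ l : Fin N, ((((‖k‖ ^ 2 : ℝ) : ℂ)) * (cellWave L m (X j) * conj (cellWave L m (X l)) *
          (((u X : ℝ) : ℂ) * ((u X : ℝ) : ℂ))) -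
        Complex.I * (cellWave L m (X j) * conj (cellWave L m (X l)) *
          (2 * (((u X : ℝ) : ℂ) * ((fderiv ℝ u X (Pi.single j k) : ℝ) : ℂ))))) := by
    intro X
    rw [map_mul, Complex.conj_ofReal, map_sum, Finset.sum_mul, Finset.sum_mul, Finset.sum_comm]
    refine Finset.sum_congr rfl fun j _ => ?_
    rw [Finset.mul_sum]
    refine Finset.sum_congr rfl fun l _ => ?_
    ring
  simp_rw [hexp]
  have hI1 : ∀ j l : Fin N, Integrable (fun X => (((‖k‖ ^ 2 : ℝ) : ℂ)) *
      (cellWave L m (X j) * conj (cellWave L m (X l)) * (((u X : ℝ) : ℂ) * ((u X : ℝ) : ℂ))))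
      (volume.restrict (cellN N L)) := fun j l => by
    have h1 := hce j; have h2 := hce l
    exact integrableOn_cellN (by fun_prop) L
  have hI2 : ∀ j l : Fin N, Integrable (fun X => Complex.I * (cellWave L m (X j) * conj (cellWave L m (X l)) *
      (2 * (((u X : ℝ) : ℂ) * ((fderiv ℝ u X (Pi.single j k) : ℝ) : ℂ)))))
      (volume.restrict (cellN N L)) := fun j l => by
    have h1 := hce j; have h2 := hce l; have h3 := hduc j
    exact integrableOn_cellN (by fun_prop) L
  have hI : ∀ j l : Fin N, Integrable (fun X => (((‖k‖ ^ 2 : ℝ) : ℂ)) *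
      (cellWave L m (X j) * conj (cellWave L m (X l)) * (((u X : ℝ) : ℂ) * ((u X : ℝ) : ℂ))) -
        Complex.I * (cellWave L m (X j) * conj (cellWave L m (X l)) *
          (2 * (((u X : ℝ) : ℂ) * ((fderiv ℝ u X (Pi.single j k) : ℝ) : ℂ)))))
      (volume.restrict (cellN N L)) := fun j l => (hI1 j l).sub (hI2 j l)
  rw [integral_finsetSum _ fun j _ => integrable_finsetSum _ fun l _ => hI j l]
  have hin : ∀ j : Fin N, ∫ X in cellN N L, ∑ l : Fin N, ((((‖k‖ ^ 2 : ℝ) : ℂ)) *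
      (cellWave L m (X j) * conj (cellWave L m (X l)) * (((u X : ℝ) : ℂ) * ((u X : ℝ) : ℂ))) -
        Complex.I * (cellWave L m (X j) * conj (cellWave L m (X l)) *
          (2 * (((u X : ℝ) : ℂ) * ((fderiv ℝ u X (Pi.single j k) : ℝ) : ℂ))))) =
      (((‖k‖ ^ 2 : ℝ) : ℂ)) * ∫ X in cellN N L, ((u X : ℝ) : ℂ) * ((u X : ℝ) : ℂ) := by
    intro j
    rw [integral_finsetSum _ fun l _ => hI j l]
    have hblock : ∀ l : Fin N, ∫ X in cellN N L, ((((‖k‖ ^ 2 : ℝ) : ℂ)) *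
        (cellWave L m (X j) * conj (cellWave L m (X l)) * (((u X : ℝ) : ℂ) * ((u X : ℝ) : ℂ))) -
          Complex.I * (cellWave L m (X j) * conj (cellWave L m (X l)) *
            (2 * (((u X : ℝ) : ℂ) * ((fderiv ℝ u X (Pi.single j k) : ℝ) : ℂ))))) =
        ((((‖k‖ ^ 2 : ℝ) : ℂ)) - (((if j = l then (0 : ℝ) else ‖k‖ ^ 2) : ℝ) : ℂ)) *
          ∫ X in cellN N L, cellWave L m (X j) * conj (cellWave L m (X l)) *
            (((u X : ℝ) : ℂ) * ((u X : ℝ) : ℂ)) := by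
      intro l
      rw [integral_sub (hI1 j l) (hI2 j l), integral_const_mul, integral_const_mul,
        integral_pairPhase_mul_mul_fderiv m hL hk hu huper j l]
      have hI : Complex.I * Complex.I = -1 := Complex.I_mul_I
      linear_combination ((((if j = l then (0 : ℝ) else ‖k‖ ^ 2) : ℝ) : ℂ) *
        ∫ X in cellN N L, cellWave L m (X j) * conj (cellWave L m (X l)) *
          (((u X : ℝ) : ℂ) * ((u X : ℝ) : ℂ))) * hI
    simp_rw [hblock]
    rw [Finset.sum_eq_single j (fun l _ hl => by rw [if_neg (Ne.symm hl), sub_self, zero_mul])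
      (fun h => absurd (Finset.mem_univ j) h), if_pos rfl, Complex.ofReal_zero, sub_zero]
    congr 1
    refine integral_congr_ae (ae_of_all _ fun X => ?_)
    dsimp only
    rw [Complex.mul_conj, Complex.normSq_eq_norm_sq, norm_cellWave]
    push_cast
    ring
  simp_rw [hin]
  rw [Finset.sum_const, Finset.card_univ, Fintype.card_fin, nsmul_eq_mul]
  have hsq : ∫ X in cellN N L, ((u X : ℝ) : ℂ) * ((u X : ℝ) : ℂ) = ((∫ X in cellN N L, u X ^ 2 : ℝ) : ℂ) := by
    rw [← integral_complex_ofReal]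
    refine integral_congr_ae (ae_of_all _ fun X => ?_)
    dsimp only
    push_cast
    ring
  rw [hsq]
  push_cast
  ring

end FSum

/-! ### The phase weight `|e_a - e_b|² = 2(1 - cos k·(x_a - x_b))` -/

/-- `|e^{iθ} - 1|² = 2(1 - cos θ)`. [folklore] -/
theorem norm_exp_mul_I_sub_one_sq (θ : ℝ) :
    ‖Complex.exp (θ * Complex.I) - 1‖ ^ 2 = 2 * (1 - Real.cos θ) := by
  have hre : (Complex.exp (θ * Complex.I)).re = Real.cos θ := Complex.exp_ofReal_mul_I_re θ
  have him : (Complex.exp (θ * Complex.I)).im = Real.sin θ := Complex.exp_ofReal_mul_I_im θ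
  rw [Complex.sq_norm, Complex.normSq_apply]
  simp only [Complex.sub_re, Complex.one_re, Complex.sub_im, Complex.one_im, hre, him]
  nlinarith [Real.sin_sq_add_cos_sq θ]

/-- `e_m(y) = exp(i k·y)` with `k = 2πm/L`. [folklore] -/
theorem cellWave_eq_exp_inner (L : ℝ) (m : Fin 3 → ℤ) (y : Space) :
    cellWave L m y = Complex.exp ((inner ℝ ((2 * Real.pi / L) • latticeVec 1 m) y : ℝ) * Complex.I) := by
  set k : Space := (2 * Real.pi / L) • latticeVec 1 m with hk
  have hkc : ∀ c, k c = 2 * Real.pi / L * (m c : ℝ) := fun c => by simp [hk, latticeVec]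
  have hin : inner ℝ k y = ∑ c : Fin 3, k c * y c := by
    simp only [PiLp.inner_apply, RCLike.inner_apply, conj_trivial]
    exact Finset.sum_congr rfl fun c _ => mul_comm _ _
  rw [cellWave_apply, hin]
  congr 1
  push_cast
  rw [Finset.mul_sum, Finset.sum_div, Finset.sum_mul]
  refine Finset.sum_congr rfl fun c _ => ?_
  rw [hkc c]
  push_cast
  ring

/-- **The phase weight of a pair**: `|e_m(x) - e_m(y)|² = 2(1 - cos(k·(x - y)))`, `k = 2πm/L`.
[folklore] -/
theorem norm_cellWave_sub_cellWave_sq (L : ℝ) (m : Fin 3 → ℤ) (x y : Space) :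
    ‖cellWave L m x - cellWave L m y‖ ^ 2 =
      2 * (1 - Real.cos (inner ℝ ((2 * Real.pi / L) • latticeVec 1 m) (x - y))) := by
  rw [norm_cellWave_sub_cellWave, cellWave_eq_exp_inner, norm_exp_mul_I_sub_one_sq]

end CurrentSumRule

end Summit.AtomisticToContinuum.BoseEinsteinCondensation.Theorems

end
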